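import Mathlib.FieldTheory.IsAlgClosed.AlgebraicClosure
import Mathlib.FieldTheory.IsAlgClosed.Basic
import Literature.NumberTheory.EllipticCurves.TorsionCardinality
import HarnessLib

/-!
# `φₙ` and `ψₙ²` are coprime (Silverman, *AEC*, Exercise 3.7(c)) — discharge

Topic `NumberTheory/EllipticCurves`; sibling of `DivisionPolynomialTorsion.lean`, whose named fact
`WeierstrassCurve.isCoprime_Φ_ΨSq V` (Silverman, *The Arithmetic of Elliptic Curves*, 2nd ed.,
Exercise 3.7(c), p. 105: "If `Δ ≠ 0`, prove that `φₘ(x)` and `ψₘ(x)²` are relatively prime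
polynomials in `K[x]`"; in Mathlib's univariate form `IsCoprime (V.Φ n) (V.ΨSq n)` for an elliptic
curve `V` over a field `K` and every `n : ℤ`) is discharged here:
`WeierstrassCurve.isCoprime_Φ_ΨSq_holds : V.isCoprime_Φ_ΨSq`.

## Proof

Two polynomials over a field are coprime iff they have no common root in an algebraic closure
`K̄` (Mathlib: `Polynomial.isCoprime_iff_aeval_ne_zero_of_isAlgClosed`). Over `K̄` every `a` is the
abscissa of an affine point `(a, b)` of `V` (`WeierstrassCurve.exists_equation`, the Weierstrass
equation being monic quadratic in `y`), nonsingular because `Δ ≠ 0`; and at the abscissa of a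
nonsingular point `Φₙ` and `ΨSqₙ` do not both vanish
(`WeierstrassCurve.eval_Φ_ne_zero_of_eval_ΨSq_eq_zero`, tree file `TorsionCardinality.lean`: by the
multiplication formula, Exercise 3.7(d),(f) — tree file `DivisionPolynomialMultiplication.lean` —
a common root would give a nonzero point killed by `n` and by `n + 1` or `n - 1`, as
`Φₙ = X·ΨSqₙ − ψₙ₊₁ψₙ₋₁`). Finally `Φₙ`, `ΨSqₙ` commute with base change (`map_Φ`, `map_ΨSq`).
This is the order of Exercise 3.7 reversed ((d) ⇒ (c)); Silverman intends (c) as an input to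
`deg [m] = m²` (3.7(e)), which the tree obtains instead by counting fibres
(`WeierstrassCurve.card_torsionBy_eq_sq`).

## References

* J. H. Silverman, *The Arithmetic of Elliptic Curves*, 2nd ed., GTM 106, Springer 2009,
  Exercise 3.7(c) (p. 105 of the held text; cf. Exercise 3.1, p. 104, the case `m = 2`).
  [SilvermanAEC2009]

## Design

A separate file rather than an append to `DivisionPolynomialTorsion.lean`: the proof uses
`TorsionCardinality.lean`, which imports `DivisionPolynomialMultiplication.lean`, which imports
`DivisionPolynomialTorsion.lean`. No new definitions; one deliberate dot-notation extension of
Mathlib's `WeierstrassCurve` (the `_holds` discharge of the fact declared there).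
-/

noncomputable section

open Polynomial

namespace WeierstrassCurve

universe u

variable {K : Type u} [Field K] (V : WeierstrassCurve K)

/-- **Silverman, AEC, Exercise 3.7(c)** (discharge of the named fact
`WeierstrassCurve.isCoprime_Φ_ΨSq`): for an elliptic curve `V` over a field `K` and every `n : ℤ`,
the univariate polynomials `Φₙ` (numerator of `x ∘ [n]`) and `ΨSqₙ = ψₙ²` (its denominator) are
coprime in `K[X]`. Proof: no common root in `K̄` — above any `a ∈ K̄` lies a nonsingular point of
`V`, where `Φₙ(a) ≠ 0` whenever `ΨSqₙ(a) = 0` (`eval_Φ_ne_zero_of_eval_ΨSq_eq_zero`, from the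
multiplication-by-`n` formula, Exercise 3.7(d),(f)). [cite: SilvermanAEC2009, Exercise 3.7(c)] -/
theorem isCoprime_Φ_ΨSq_holds : V.isCoprime_Φ_ΨSq := by
  intro _ n
  refine (Polynomial.isCoprime_iff_aeval_ne_zero_of_isAlgClosed K (AlgebraicClosure K) _ _).mpr ?_
  intro a
  -- a (nonsingular) point of `V` over `K̄` with abscissa `a`
  obtain ⟨b, hb⟩ := (V.map (algebraMap K (AlgebraicClosure K))).exists_equation a
  have hns : (V.map (algebraMap K (AlgebraicClosure K))).toAffine.Nonsingular a b :=
    Affine.equation_iff_nonsingular.mp hb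
  refine or_iff_not_imp_right.mpr fun hΨ => ?_
  rw [Ne, not_not, ← eval_map_algebraMap, ← map_ΨSq] at hΨ
  rw [Ne, ← eval_map_algebraMap, ← map_Φ]
  exact eval_Φ_ne_zero_of_eval_ΨSq_eq_zero _ hns hΨ

end WeierstrassCurve
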